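import Mathlib
import HarnessLib
import HarnessLib.Audit
import Summits.HodgeConjecture.Statement
import Literature.Geometry.Kaehler.AnalyticSet
import Literature.Geometry.Kaehler.Kaehler
import Literature.NumberTheory.Transcendental.ComplexFormsHighType
import Literature.Geometry.Kaehler.NearlyHolomorphicCycleSupport
import Literature.AlgebraicGeometry.HodgeTheory.HodgeModelChernNormalised
import Literature.AlgebraicGeometry.HodgeTheory.KaehlerClass
import Literature.AlgebraicGeometry.HodgeTheory.HardLefschetzNFold
import Summits.HodgeConjecture.HodgeConjecture.Theorems.HolomorphicDefectHodgeModelsExist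
import HarnessLib.Audit.Status.Attr

/-!
Route: HolomorphicityRate

DORMANT since 2026-08-24T19:49:43Z (reconciler: no traction for 7 d (last activity statement-grounded at 2026-08-17T18:41:12Z); parked, not closed — `ledger route dormant route-HodgeConjecture-HolomorphicityRate --off` to reactivate) — unstaffed, not closed; items shared with open routes are served there. `ledger route dormant <id> --off` reactivates.

# Route HolomorphicityRate — Hodge as a rate gap on the PINNED Kodaira ray: carriers with decaying
(0,2)-curvature give super-threshold nearly-holomorphic representatives of m·c + k^p·d·h^p, and
super-threshold representatives are LOCALLY rigid (an analytic carrier inside a shrinking tube)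

It suffices to show X = R1a ∧ R1b ∧ R2″ for 1 ≤ p < n on a smooth projective n-fold X, a
CHERN-NORMALISED Hodge model A
(A.deRham = integration ⊗ ℂ, so Chern–Weil and Betti classes may be equated) and a hard-Lefschetz
datum Λ whose class h is
KÄHLER (PolarisedLefschetzData: one exists, all h^p algebraic). A representative of DEFECT ≤ t is a
nearly holomorphic cycle
support (Literature.Geometry.Kaehler.IsNearlyHolomorphicCycleSupport g p t S Sg: closed S ⊇ Sg, S∖Sg
a connected C¹ real
codim-2p submanifold whose tangent planes have J-defect ≤ t in the metric g, S analytic near Sg, Sg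
inside an analytic set of
codim ≥ p+1); it CARRIES a class when the pull-back of the class to X^an dies on X^an ∖ S.
R1a (CarrierCurvatureDecay, crux 2): a rational (p,p) class c has a rank-p C^∞ Hermitian carrier F
(c_1 = … = c_{p-1} = 0,
c_p(F) = m·c, m ≥ 1) with unitary connections D_k of curvature ≤ C·k^{1-δ} and (0,2)-curvature ≤
C·k^{1-p-δ}.
R1b (AHGlobalisationWithRate, crux 4): for such a carrier and h Kähler, zero loci of asymptotically
holomorphic sections of
F ⊗ L^k (c_1(L) = d′h) are, for all large k, connected nearly holomorphic cycle supports (Sg = ∅) of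
defect ≤ C′·k^{-(p+δ)}
carrying c_p(F) + k^p·d·h^p.  Glue RateGapPinnedOfCarriers: R1a → R1b → RateGapPinned (waypoint:
super-threshold
representatives of m·c + k^p·d·h^p for infinitely many k).
R2″ (SuperThresholdRigidityLocal, crux 3 — fixed-k, LOCALISED rigidity): for a rational (p,p) class
c, a pinned ray
γ_k = m·c + a_k·d·h^p (a_k ≤ C·k^p) and a defect scale C′·k^{-(p+δ)} there is a radius sequence ρ_k
→ 0 such that for all
large k EVERY nearly holomorphic cycle support S of defect ≤ C′·k^{-(p+δ)} carrying γ_k admits a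
closed ANALYTIC subset T,
regular points of codimension ≥ p, carrying γ_k INSIDE the g-geodesic ρ_k-tube of S.  HC hands out
an algebraic representative
of γ_k but none near a sparse S, so R2″ does not fold onto HC≤middle the way R2
(SuperThresholdRigidity, aside) and R2′
(SuperThresholdRigidityPinned, retired rev 7: superThresholdRigidityPinned_of_hodgeBelowMiddle,
representatives idle) did.
Chow/GAGA (AnalyticSupportAlgebraic, proved) makes the tube member algebraic; subtract a_k·d·h^p ∈
Nᵖ and divide by m.
Lean: `CarrierCurvatureDecay ∧ AHGlobalisationWithRate ∧ SuperThresholdRigidityLocal` (decls below);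
deciding theorem
`closes : CarrierCurvatureDecay → AHGlobalisationWithRate → RateGapPinnedOfCarriers →
SuperThresholdRigidityLocal →
PolarisedLefschetzData → AnalyticSupportAlgebraic → HodgeModelsExist → HodgeConjecture`.

## Assembly
Logic + ℂ-submodule arithmetic, sorry-free (planner SketchRender.lean = the gate's render, lean
check rc 0, audit closes OK), NO model
transport and no Morse-theoretic import in the route file: lower half 2p ≤ n — p = 0 is
algebraicClasses_zero; for 1 ≤ p
Chern-normalise the ∃-model of the summit's Hodge-type hypothesis (HodgeModel.chernNormalise: same
carrier, same pull-back), take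
Λ from PolarisedLefschetzData, run RateGapPinned (via the glue from R1a, R1b) and R2″ in that model
— the frequently-in-k supports
of the waypoint meet the eventually-in-k radius clause of R2″ (Filter.Frequently.and_eventually),
the tube clause is discarded —
apply AnalyticSupportAlgebraic to the analytic T, subtract, divide by m ≠ 0; upper half n < 2p
(including p > n) —
HardLefschetzNFold.mem_algebraicClasses_of_lt reduces codimension p to codimension n − p ≤ n/2.  The
PIN (h Kähler, quantified
before c, summand a positive multiple of h^p) keeps the rate load-bearing and the LOCALISATION keeps
the rigidity load-bearing:
with a free algebraic summand hp the cancellation hp := −c made the old R1/R2 (RateGap,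
SuperThresholdRigidity — asides,
hides-summit: hodgeConjecture_iff_hodgeMiddle / hodgeConjecture_iff_hodgeBelowMiddle) equivalent to
HC below the middle, and
without the tube "γ_k is algebraic" closed R2′ outright under HC≤middle.

Rationale: WHY THIS LINE. The card replaces "is c algebraic?" by an EXPONENT on the Kodaira ray: every rational
class has
representatives of J-defect ≲ k^{-1/2} (zero loci of asymptotically holomorphic sections of E ⊗ L^k
for a C^∞
carrier E with c_p(E) = m·c [Donaldson1996, Auroux1997, MunozPresasSols2002]); a defect o(k^{-p})
FORCES type (p,p)
(ThresholdForcesHodgeType, E2: off-type forms die on complex (n−p)-planes, |⟨c ∪ ψ⟩| ≲ θ_k·k^p,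
Serre duality); so HC reads
"Hodge classes beat the threshold k^{-p} (R1a+R1b) and beating it is rigid NEAR THE REPRESENTATIVE
(R2″)". With J integrable and
holomorphic peak sections of L^k the only source of defect is the carrier's (0,1)-connection part,
|A^{0,1}| ≲ |F^{0,2}_E|/k in
g_k-units: the Hodge condition is exactly the vanishing of the cohomological obstruction
((0,2)-periods) to flattening F^{0,2}, and
for p = 1 Lefschetz (1,1) in Chern–Weil form gives F^{0,2} = 0 on the nose. Imports: approximately
holomorphic geometry, GMT of
holomorphic chains [King1971, HarveyShiffman1974], Kähler-angle rigidity [HanLi2005, ArezzoSun2015]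
(= R2″ with a constant
threshold and no rate where H^{0,2} = 0), gauge-theoretic ancestor [Ramadas2008Spin7].
RANKED CRUXES. #2 CarrierCurvatureDecay (R1a, flexibility: carriers with sup|F^{0,2}| ≤ C k^{1-p-δ};
may fail by a
curvature GAP for some Hodge Chern vector, first test Weil classes on Weil-type abelian fourfolds
where HC is Markman's
theorem). #3 SuperThresholdRigidityLocal (R2″: fixed-k Newton–Kuranishi correction of a
super-threshold support by normal graphs
in (X, kω), ρ_k ~ θ_k·k^{-1/2} × inverse spectral gap of the normal ∂̄-operator, limit recognised by
King / Harvey–Shiffman; may fail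
because smallness kills no cokernel — k-independent non-abelian blocks, near-zero modes of the
linearised normal ∂̄ at polynomial
scales forcing corrections ≫ defect, singular bad sets for which a geodesic tube is the wrong
localisation). #4
AHGlobalisationWithRate (R1b, known-mathematics-PLUS: Donaldson–Auroux globalisation with the rate
inherited from the carrier; may
fail if only the printed k^{-1/2} gain survives the transversality iteration). Supports:
RateGapPinned (waypoint),
RateGapPinnedOfCarriers (glue R1a → R1b → waypoint; provable now: logic + linearity + one transport
by the PROVED
hodgePQ_independent_of_hodgeModel_holds, done in the Theorems file), PolarisedLefschetzData
(provable now, Fubini–Study; h^p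
algebraic for every hard-Lefschetz datum by iterating lefschetzOperator_mem_algebraicClasses from h⁰
= 1 — proved as
cupPowTwo_hyperplaneClass_mem_algebraicClasses_of_hardLefschetzNFold in the supports file of the
retired R2′, to be re-landed standalone),
ThresholdForcesHodgeType (E2, calibration of the threshold, not on the closes path); proved:
AnalyticSupportAlgebraic,
HodgeModelsExist, TargetSuffices, TargetOfCruxes, Assembly. Asides, not on the closes path: RateGap,
SuperThresholdRigidity
(hides-summit as typed — free summand hp), Target (HC-equivalent delivered target of the old chain).
Retired: SuperThresholdRigidityPinned
(R2′, folds onto HC≤middle: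
Theorems/HolomorphicityRateSuperThresholdRigidityPinnedOfHodgeBelowMiddle.lean).
KILL CRITERIA. (i) A curvature-gap theorem (inf over rank-p carriers of k^{p-1}·sup|F^{0,2}| > 0
along every admissible
family) for one genuine Hodge class refutes CarrierCurvatureDecay: pivot to non-bundle carriers
(chains of nearby
Hodge-locus members) or close `refuted:CarrierCurvatureDecay`. (ii) ¬SuperThresholdRigidityLocal
witnessed by super-threshold
supports S_k of a class forced Hodge by E2 with NO analytic carrier of γ_k in any o(1)-tube (e.g.
knotted nearly-holomorphic
symplectic surfaces at super-threshold defect) kills the localisation: fall back to a tube of fixed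
radius / Hausdorff-limit form,
or close `refuted` and file the witness as a negative. (iii) If AHGlobalisationWithRate only holds
with exponent 1/2 + (carrier
gain), re-derive: the line survives iff some admissible exponent still beats p; otherwise close
`exhausted` with census.
NOT DECOMPOSED YET. No estimated-transversality constants or peak-section asymptotics as items;
inside R2″ no choice yet between
Newton on normal graphs and symplectic mean-curvature flow, and its honest layer-2 pieces
(normal-graph parametrisation of C¹
supports inside the k^{-1/2}-tube, k-positivity of the linearised normal ∂̄ as an L² estimate,
quadratic remainder ∝ θ², recognition
of the limit — the last already landed as stub_holomorphicSupportIsAnalytic and pieces) are stubs of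
its first line, not items; no
uniform-geometry upgrade; the p = 1 model of R2″ (H^{0,2}-pinned cokernel: 0 → O → O(Z_k) → N → 0
and Serre vanishing) is the first
line to register. Two layers only.
CHEAPEST FALSIFIER. AHGlobalisationWithRate at p = 1 with the TRIVIAL flat carrier (F = O, D_k = d):
zero loci of
holomorphic sections of L^k must come out as connected smooth hypersurfaces of defect 0 carrying
k·d·h (checks the normalisations
against Bertini/Lefschetz); then CarrierCurvatureDecay at p = 1 (= Lefschetz (1,1) in Chern–Weil
form, in tree). For R2″: p = n−1
= 1 on a surface with a_k = 0 (fixed class m·c): the statement must reduce to Gromov compactness of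
nearly-holomorphic surfaces in a
fixed class (Hausdorff limit = a holomorphic curve carrying m·c) — if even that fails for C⁰-small
Kähler angle, R2″ is mis-typed.
First open test: p = 2, a Weil class on a Weil-type abelian fourfold (is k·sup|F^{0,2}| of rank-2
carriers bounded below?). Not
kit-runnable.

Novelty: Searches (2026-08-15): zbMATH "Kähler angle symplectic submanifold" (9: Smoczyk 2002, ArezzoSun2015,
Li–Sun 2024, …), "symplectic
mean curvature flow Kähler angle holomorphic curve" (2: HanLi2005 doi:10.1155/imrn.2005.1611,
Li–Yang 2014), "Hodge conjecture
symplectic submanifolds Donaldson asymptotically holomorphic" (0), "transcendental cohomology class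
symplectic representative Kähler"
(0), "nonsmoothing of algebraic cycles" (HartshorneReesThomas1974 — why representatives may be
singular), "Harvey Shiffman holomorphic
chains" (HarveyShiffman1974, Shiffman 1986), "holomorphic chains rectifiable currents King"
(Teh–Yang arXiv:1810.00355); lit frontier
HodgeConjecture --since 2020 (30 descendants of the root set, none symplectic/AH); lit bridges
HodgeConjecture --cross any (none
relevant); local searchd/galaxy unavailable (D-0023 outage) — the card's two refuter audits (r14)
already ran galaxy/hybrid and found
no holomorphicity exponent in print. Nearest prior art found: Ramadas2008Spin7 (arXiv:0809.3927: HC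
via gauge theory on the smooth
carrier, Prop. 4.1 integrability defect = Hodge pairing) — the published ancestor of the
approximate-integrability crux; Donaldson1996 /
Auroux1997 / MunozPresasSols2002 (the rate-1 representatives, never pointed at Hodge classes);
HanLi2005 and ArezzoSun2015
(Kähler-angle pinching / variational rigidity of complex submanifolds = R2 with a constant threshold
where H^{0,2} = 0);
HarveyLawson2009-circle (Hodge question for calibrated cycles, ma  [refs: 10.1155/imrn.2005.1611, 1810.00355, 0809.3927, doi:10.1155/imrn.2005.1611, ArezzoSun2015, HanLi2005, HartshorneReesThomas1974, HarveyShiffman1974, Donaldson1996, Auroux1997, MunozPresasSols2002, HarveyLawson2009]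

Barriers (technique_class: complex-analytic, asymptotically-holomorphic, kaehler-angle): - technique_class: complex-analytic, asymptotically-holomorphic, kaehler-angle
- Literature.Barriers.HodgeConjecture.Zucker1977_kaehlerTorus_noAnalyticCycles: every item has
`IsSmoothProjective n X` as hypothesis and the ray needs an algebraic class hp and (for the
constructions) the prequantum line bundle L = O(1); on Zucker's tori there is no Kodaira scaling,
UniversalRateOne/RateGap make no claim, and indeed their conclusions fail there — the projective
input is used, not argued away.
- Literature.Barriers.HodgeConjecture.Voisin2002_weilTorus_hodgeClassWithoutSubvarieties: same
structural evasion; moreover RateGap in carrier form must FAIL on the Weil torus (no sheaf carries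
the class), consistent since no L exists to run the AH machine; refuters should check that any
proposed proof of RateGap breaks there.
- Literature.Barriers.HodgeConjecture.AtiyahHirzebruch1962_torsionClass_notAlgebraic: all items
carry an existential multiple m ≥ 1 and complex/rational coefficients; integral classes enter only
as the fundamental classes [S_k] of representatives, never as c.
- Literature.Barriers.HodgeConjecture.Kollar1992_nonTorsionClass_notAlgebraic: idem — Target/RateGap
assert ∃ m, never m = 1; the carriers exist only after multiples (BU(p) rational splitting).
- Literature.Barriers.HodgeConjecture.Weil1977_exceptionalHodgeClasses: no divisor monomials
anywhere; carriers are rank-p bundles / their zero loci, representatives arbitrary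
nearly-holomorphic cycles; Weil classes on abeli

History (route lifecycle, newest last):
- 2026-08-17T09:29:53Z · skeleton.hides-summit: stub_hodgeBelowMiddle (stmt-HodgeConjecture-2737) ⟷ summit (accepted theorem in Summits/HodgeConjecture/HodgeConjecture/Theorems/HolomorphicityRateRateGapOfHodgeMiddle.lean) (prover-line-stmt-HodgeConjecture-10762-c3-0)
- 2026-08-17T09:29:53Z · skeleton.hides-summit: stub_hodgeMiddle (stmt-HodgeConjecture-10762) ⟷ summit (accepted theorem in Summits/HodgeConjecture/HodgeConjecture/Theorems/HolomorphicityRateRateGapOfHodgeMiddle.lean) (prover-line-stmt-HodgeConjecture-10762-c3-0)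
- 2026-08-17T10:31:33Z · rev 5: dropped NonHodgeRateAtMostOne, UniversalRateOne, stmt-HodgeConjecture-2902 — route-repair (rbadge g3) step 0: drop three non-load-bearing items to make room for the carrier split — NonHodgeRateAtMostOne (stmt-2738: suspect-FALSE as typed (planner-rbadge-HodgeConjecture-HolomorphicityR-70b5ba77-g3-0)
- 2026-08-17T11:20:04Z · rev 7: restated RateGapPinned (stmt-HodgeConjecture-18024), SuperThresholdRigidityPinned (stmt-HodgeConjecture-18022) — route-repair (rbadge g4): (1) RESTATE RateGapPinned (18024, support) and SuperThresholdRigidityPinned (18022, crux) 1:1 — Hodge-type hypothesis in the summit's (planner-rbadge-HodgeConjecture-HolomorphicityR-70b5ba77-g4-0)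
- 2026-08-17T13:45:21Z · rev 7: restated RateGapPinnedOfCarriers (stmt-HodgeConjecture-18025) — route-repair (rbadge g7): re-render rev 7; closes now binds the corrected localised rigidity crux R2'' (stmt-18204 SuperThresholdRigidityLocal); DROP R2' SuperT (planner-rbadge-HodgeConjecture-HolomorphicityR-70b5ba77-g7-0)
- 2026-08-17T13:45:21Z · rev 7: dropped SuperThresholdRigidityPinned — route-repair (rbadge g7): re-render rev 7; closes now binds the corrected localised rigidity crux R2'' (stmt-18204 SuperThresholdRigidityLocal); DROP R2' SuperT (planner-rbadge-HodgeConjecture-HolomorphicityR-70b5ba77-g7-0)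
- 2026-08-17T14:48:29Z · rev 9: dropped stmt-HodgeConjecture-18204 — route-repair (rbadge g8) step 1/2 (TRANSIENT, minutes): drop the kind-less row of stmt-HodgeConjecture-18204 (R2″, filed via workitem add without decl_name/kind (planner-rbadge-HodgeConjecture-HolomorphicityR-70b5ba77-g8-0)
- 2026-08-24T19:49:43Z · DORMANT — reconciler: no traction for 7 d (last activity statement-grounded at 2026-08-17T18:41:12Z); parked, not closed — `ledger route dormant route-HodgeConjecture-Hol (operator:999:3013420)

sub-problem: HodgeConjecture · status: dormant · opened planner-plancard-HodgeConjecture-HodgeConject-5710aed0-0 2026-08-15T11:07:26Z · rev 11 · ledger route-HodgeConjecture-HolomorphicityRate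
GENERATED by the gate from the ledger (D-0016/17). Provers cite these decls: `theorem foo : Summit.HodgeConjecture.HodgeConjecture.Theses.HolomorphicityRate.<Decl> := …` in Summits/HodgeConjecture/HodgeConjecture/Theorems/<Name>.lean.
-/

namespace Summit.HodgeConjecture.HodgeConjecture.Theses.HolomorphicityRate

open scoped BigOperators Topology Manifold Classical MeasureTheory ProbabilityTheory Matrix InnerProductSpace ComplexConjugate ContinuousMap
open Filter Set Function TopologicalSpace MeasureTheory

attribute [summit_statement] _root_.HodgeConjecture

/-- item stmt-HodgeConjecture-18021 · crux · rank 2 · open · by planner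
why it might fail: A curvature GAP may hold: for some Hodge Chern vector (first test: Weil classes on a Weil-type abelian fourfold, where HC is Markman's theorem) every rank-p carrier family with |F| <= C k^{1-delta} keeps sup|F^{0,2}| >~ k^{1-p} (non-abelian H^{0,2}(End)-type obstruction, Ramadas2008Spin7).
sources: Ramadas2008Spin7, DebartolomeisTian1996, Kobayashi1987, Markman2025SecantWeil, VoisinHodgeI2002, Donaldson1996
[crux] R1a, FLEXIBILITY half of the repaired rate gap (carrier split of RateGap stmt-10762, the
route's TWO-LAYER PLAN, typable since SmoothHermitianBundleTensor / HodgeModelChernNormalised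
landed): for X smooth projective of dimension n, 1 <= p < n, a CHERN-NORMALISED Hodge model A
(A.deRham = de Rham's integration comparison, so Chern-Weil and Betti classes may be equated) and a
rational class c with A^*c in H^{p,p}, there are a smooth metric g, a C-infinity Hermitian bundle F
of rank p on X^an with ch_i(F) = 0 (0 < i < p) and (-1)^{p-1}(p-1)! ch_p(F) = m A^*c (m >= 1; i.e.
c_1 = ... = c_{p-1} = 0, c_p(F) = m c), delta > 0, C and unitary connections D_k such that for all
large k the full curvature has pointwise comass <= C k^{1-delta} and its (0,2)-part comass <= C
k^{1-p-delta} (|Omega(v,w)|_h^2 <= (C k^e)^2 g(v,v) g(w,w)). In g_k = k g units: |F| <= C k^{-delta}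
-> 0 (nearly flat at the Donaldson scale k^{-1/2}) and |F^{0,2}| <= C k^{-(p+delta)}, BELOW the E2
threshold k^{-p}; consistently the off-type part of the Chern-Weil form of ch_p decays like k^{-p
delta}. p = 1 is Lefschetz (1,1) in Chern-Weil form (a rational (1,1) class is c_1 of a holomorphic
Hermitian line bundle: D -/
@[route_item "route-HodgeConjecture-HolomorphicityRate", crux]
def CarrierCurvatureDecay : Prop :=
  ∀ (n p : ℕ) (X : Literature.AlgebraicGeometry.Motives.SchemeOver ℂ), Literature.AlgebraicGeometry.Motives.IsSmoothProjective n X → 1 ≤ p → p < n → ∀ (A : Literature.AlgebraicGeometry.HodgeTheory.HodgeModel n X), A.IsChernNormalised → ∀ (c : Literature.AlgebraicGeometry.HodgeTheory.complexBetti X (2 * p)), Literature.AlgebraicGeometry.HodgeTheory.IsRationalClass c → A.pullback (2 * p) c ∈ A.hodgePQ (2 * p) p p → ∃ (g : Bundle.ContMDiffRiemannianMetric 𝓘(ℝ, A.model) ((⊤ : ℕ∞) : WithTop ℕ∞) A.model (fun x : A.carrier => TangentSpace 𝓘(ℝ, A.model) x)) (F : Literature.Geometry.Kaehler.SmoothHermitianBundle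 A.model A.carrier) (m : ℕ) (C δ : ℝ) (D : ℕ → Literature.Geometry.Kaehler.UnitaryConnection A.model F.Fiber F.metric), 0 < m ∧ 0 < δ ∧ F.rank = p ∧ (∀ i : ℕ, 0 < i → i < p → F.chernCharacter A.deRham i = 0) ∧ ((-1 : ℂ) ^ (p - 1) * ((p - 1).factorial : ℂ)) • F.chernCharacter A.deRham p = (m : ℂ) • A.pullback (2 * p) c ∧ ∀ᶠ k : ℕ in Filter.atTop, ∀ (x : A.carrier) (v w : TangentSpace 𝓘(ℝ, A.model) x), Literature.Geometry.Kaehler.endNormSq (F.metric.frameOp x x) ((D k).curvature x x ![v, w]) ≤ (C * (k : ℝ) ^ (1 - δ)) ^ 2 * (g.inner x v v * g.inner x w w) ∧ Literature.Geometry.Kaehler.endNormSq (F.metric.frameOp x x) ((D k).curvatureZeroTwo x x ![v, w]) ≤ (C * (k : ℝ) ^ (1 - (p : ℝ) - δ)) ^ 2 * (g.inner x v v * g.inner x w w)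

/-- item stmt-HodgeConjecture-18299 · crux · rank 3 · open · by planner
why it might fail: Stronger than anything HC gives: near-zero modes of the linearised normal dbar-operator at polynomial scales in k can force corrections far larger than the defect (no analytic carrier of gamma_k inside a shrinking tube), and for Sg nonempty a geodesic tube may be the wrong localisation.
sources: HanLi2005, ArezzoSun2015, Donaldson1996, King1971, HarveyShiffman1974, arXiv:0802.0946
[crux] R2″, fixed-k LOCALISED super-threshold rigidity (the corrected rigidity crux C′ for the
hides-summit R2 stmt-2737 / the HC-foldable R2′ stmt-18080; same statement as
stmt-HodgeConjecture-18204 (filed by rbadge g7 via workitem add without decl_name/kind, mooted rev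
9), re-filed as a badged crux by rbadge g8): for X smooth projective, 1 ≤ p < n, any Hodge model A,
a hard-Lefschetz datum Λ with Kähler h, a smooth metric g, a rational class c of type (p,p), m, d ≥
1, a_k ≤ C·k^p, δ > 0, C′: there is a radius sequence ρ_k → 0 such that for all large k EVERY nearly
holomorphic cycle support S (bad set Sg) of defect ≤ C′·k^{-(p+δ)} carrying γ_k = m·c + (a_k d)·h^p
admits a closed ANALYTIC T (regular points of codim ≥ p) carrying γ_k INSIDE the g-geodesic tube {x
| ∃ y ∈ S, riemannianEDist_g x y ≤ ρ_k}. Non-folding by design: HC hands out an algebraic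
representative of γ_k but none near a sparse S (a_k = 0 is allowed), so no line through 'γ_k is
algebraic' closes it; in `closes` the tube clause is simply discarded (the AH zero loci of
RateGapPinned are k^{-1/2}-dense anyway). Intended mechanism: Newton–Kuranishi correction of S by
normal graphs in (X, kω) (ρ_k ~ θ_k·k^{-1/2} × inver -/
@[route_item "route-HodgeConjecture-HolomorphicityRate", crux]
def SuperThresholdRigidityLocal : Prop :=
  ∀ (n p : ℕ) (X : Literature.AlgebraicGeometry.Motives.SchemeOver ℂ), Literature.AlgebraicGeometry.Motives.IsSmoothProjective n X → 1 ≤ p → p < n → ∀ (A : Literature.AlgebraicGeometry.HodgeTheory.HodgeModel n X) (Λ : Literature.AlgebraicGeometry.HodgeTheory.HardLefschetzNFold n X), Literature.AlgebraicGeometry.HodgeTheory.IsKaehlerClass n X Λ.hyperplaneClass → ∀ (g : Bundle.ContMDiffRiemannianMetric 𝓘(ℝ, A.model) ((⊤ : ℕ∞) : WithTop ℕ∞) A.model (fun x : A.carrier => TangentSpace 𝓘(ℝ, A.model) x)) (c : Literature.AlgebraicGeometry.HodgeTheory.complexBetti X (2 * p)) (m d : ℕ) (C : ℝ) (a : ℕ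 → ℕ) (δ C' : ℝ), Literature.AlgebraicGeometry.HodgeTheory.IsRationalClass c → Literature.AlgebraicGeometry.HodgeTheory.IsOfHodgeType n X (2 * p) p p c → 0 < m → 0 < d → (∀ k, (a k : ℝ) ≤ C * (k : ℝ) ^ p) → 0 < δ → ∃ ρ : ℕ → ℝ, Filter.Tendsto ρ Filter.atTop (nhds 0) ∧ ∀ᶠ k : ℕ in Filter.atTop, ∀ S Sg : Set A.carrier, Literature.Geometry.Kaehler.IsNearlyHolomorphicCycleSupport g.toRiemannianMetric p (C' * (k : ℝ) ^ (-((p : ℝ) + δ))) S Sg → Literature.AlgebraicTopology.SingularHomology.singularCohomology.map ℂ ℂ (⟨Subtype.val, continuous_subtype_val⟩ : C({x : A.carrier // x ∉ S}, A.carrier)) (2 * p) (A.pullback (2 * p) ((m : ℂ) • c + ((a k * d : ℕ) : ℂ) • Literature.AlgebraicGeometry.HodgeTheory.cupPowTwo Λ.hyperplaneClass p)) = 0 → ∃ T : Set A.carrier, (Literature.Geometry.Kaehler.IsAnalyticSet 𝓘(ℂ, A.model) T ∧ ∀ x ∈ Literature.Geometry.Kaehler.regularLocus 𝓘(ℂ,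 A.model) T, ∀ q : ℕ, Literature.Geometry.Kaehler.IsRegularPointOfCodim 𝓘(ℂ, A.model) T q x → p ≤ q) ∧ Literature.AlgebraicTopology.SingularHomology.singularCohomology.map ℂ ℂ (⟨Subtype.val, continuous_subtype_val⟩ : C({x : A.carrier // x ∉ T}, A.carrier)) (2 * p) (A.pullback (2 * p) ((m : ℂ) • c + ((a k * d : ℕ) : ℂ) • Literature.AlgebraicGeometry.HodgeTheory.cupPowTwo Λ.hyperplaneClass p)) = 0 ∧ T ⊆ {x : A.carrier | ∃ y ∈ S, (open scoped Bundle in (letI : Bundle.RiemannianBundle (fun z : A.carrier => TangentSpace 𝓘(ℝ, A.model) z) := ⟨g.toRiemannianMetric⟩; Manifold.riemannianEDist 𝓘(ℝ, A.model) x y)) ≤ ENNReal.ofReal (ρ k)}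

/-- item stmt-HodgeConjecture-18023 · crux · rank 4 · open · by planner
why it might fail: Print gives |dbar s| <= C k^{-1/2}|ds| only (Donaldson1996 Thm 5, Auroux1997 Thm 2): the gain needs approximately holomorphic frames of (F, D_k) with |A^{0,1}| <~ |F^{0,2}| in g_k-units surviving Donaldson's transversality iteration with k-uniform eta; curvature growth k^{1-delta} may spoil it.
sources: Donaldson1996, Auroux1997, MunozPresasSols2002, arXiv:1803.05929, McDuffSalamon2017
[crux] R1b, Donaldson-Auroux GLOBALISATION WITH RATE for integrable J (carrier split of RateGap;
known-mathematics-PLUS): for X smooth projective, 1 <= p < n, a Chern-normalised Hodge model A, a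
hard-Lefschetz datum Lambda whose class h is KAEHLER, any smooth metric g, any C-infinity Hermitian
bundle F of rank p with ch_i(F) = 0 (0 < i < p), delta > 0, C and unitary connections D_k with
comass |F_{D_k}| <= C k^{1-delta} and |F^{0,2}_{D_k}| <= C k^{1-p-delta} for all large k: there are
d >= 1 and C' such that for all large k some CONNECTED closed C^1 submanifold S_k of real
codimension 2p (a nearly holomorphic cycle support with EMPTY bad set,
Literature.Geometry.Kaehler.IsNearlyHolomorphicCycleSupport g p t S emptyset) has Kaehler-angle
defect <= C' k^{-(p+delta)} and carries the class c_p(F) + k^p d h^p = (-1)^{p-1}(p-1)! ch_p(F) +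
(k^p d) A^*h^p (its restriction to X^an minus S_k vanishes). Intended proof: L the positive
holomorphic line bundle with c_1(L) = d' h (Lefschetz (1,1); d = d'^p); HOLOMORPHIC peak sections of
L^k tensored with approximately holomorphic local frames of (F, D_k) at g_k-unit scale (approximate
Koszul-Malgrange: |A^{0,1}| <~ |F^{0,2}|_{g_k} = O(k^{-p-delta -/
@[route_item "route-HodgeConjecture-HolomorphicityRate", crux]
def AHGlobalisationWithRate : Prop :=
  ∀ (n p : ℕ) (X : Literature.AlgebraicGeometry.Motives.SchemeOver ℂ), Literature.AlgebraicGeometry.Motives.IsSmoothProjective n X → 1 ≤ p → p < n → ∀ (A : Literature.AlgebraicGeometry.HodgeTheory.HodgeModel n X), A.IsChernNormalised → ∀ (Λ : Literature.AlgebraicGeometry.HodgeTheory.HardLefschetzNFold n X), Literature.AlgebraicGeometry.HodgeTheory.IsKaehlerClass n X Λ.hyperplaneClass → ∀ (g : Bundle.ContMDiffRiemannianMetric 𝓘(ℝ, A.model) ((⊤ : ℕ∞) : WithTop ℕ∞) A.model (fun x : A.carrier => TangentSpace 𝓘(ℝ, A.model) x)) (F : Literature.Geometry.Kaehler.SmoothHermitianBundle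 A.model A.carrier) (C δ : ℝ) (D : ℕ → Literature.Geometry.Kaehler.UnitaryConnection A.model F.Fiber F.metric), 0 < δ → F.rank = p → (∀ i : ℕ, 0 < i → i < p → F.chernCharacter A.deRham i = 0) → (∀ᶠ k : ℕ in Filter.atTop, ∀ (x : A.carrier) (v w : TangentSpace 𝓘(ℝ, A.model) x), Literature.Geometry.Kaehler.endNormSq (F.metric.frameOp x x) ((D k).curvature x x ![v, w]) ≤ (C * (k : ℝ) ^ (1 - δ)) ^ 2 * (g.inner x v v * g.inner x w w) ∧ Literature.Geometry.Kaehler.endNormSq (F.metric.frameOp x x) ((D k).curvatureZeroTwo x x ![v, w]) ≤ (C * (k : ℝ) ^ (1 - (p : ℝ) - δ)) ^ 2 * (g.inner x v v * g.inner x w w)) → ∃ (d : ℕ) (C' : ℝ), 0 < d ∧ ∀ᶠ k : ℕ in Filter.atTop, ∃ S : Set A.carrier, Literature.Geometry.Kaehler.IsNearlyHolomorphicCycleSupport g.toRiemannianMetric p (C' * (k : ℝ) ^ (-((p : ℝ) + δ))) S ∅ ∧ Literature.AlgebraicTopology.SingularHomology.singularCohomology.map ℂ ℂ (⟨Subtype.val,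 continuous_subtype_val⟩ : C({x : A.carrier // x ∉ S}, A.carrier)) (2 * p) (((-1 : ℂ) ^ (p - 1) * ((p - 1).factorial : ℂ)) • F.chernCharacter A.deRham p + ((k ^ p * d : ℕ) : ℂ) • A.pullback (2 * p) (Literature.AlgebraicGeometry.HodgeTheory.cupPowTwo Λ.hyperplaneClass p)) = 0

-- earlier Target (stmt-HodgeConjecture-2735, replaced 2026-08-15T16:23:23Z -> stmt-HodgeConjecture-10763): retired by None — ∀ (n p : ℕ) (X : Literature.AlgebraicGeometry.Motives.SchemeOver ℂ), Literature.AlgebraicGeometry.Motives.IsSmoothProjective n X → p ≤ n → ∀ (A : Literature.AlgebraicGeometry.HodgeTheory.HodgeModel n X) (c : Literature.AlgebraicGeometry.HodgeTheory.complexBetti X (2 * p)), Lit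
/-- item stmt-HodgeConjecture-10763 · aside · rank 0 · open · by planner
why it might fail: Equivalent to HC given Chow/GAGA (AnalyticSupportAlgebraic): it fails exactly where HC fails (open beyond p = 1, p = n-1 and special fourfolds); the multiple m >= 1 and the algebraic summand b are essential (Atiyah-Hirzebruch torsion classes, Kollar's non-torsion hypersurface examples).
sources: Deligne2000, VoisinHodgeI2002, SerreGAGA1956, King1971
[target] X₀ (what R1+R2 deliver): for X smooth projective of dimension n, p ≤ n, every Hodge model A
and every rational class c of type (p,p), some multiple m·c (m ≥ 1) plus an algebraic class b is
supported on a closed ANALYTIC subset S ⊆ X^an all of whose regular points have codimension ≥ p (its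
pull-back to the Hodge model dies on X^an ∖ S, the support formulation of
lefschetzOneOne_rational_of) (S = ∅ allowed: then m·c + b = 0). -/
@[route_item "route-HodgeConjecture-HolomorphicityRate"]
def Target : Prop :=
  ∀ (n p : ℕ) (X : Literature.AlgebraicGeometry.Motives.SchemeOver ℂ), Literature.AlgebraicGeometry.Motives.IsSmoothProjective n X → p ≤ n → ∀ (A : Literature.AlgebraicGeometry.HodgeTheory.HodgeModel n X) (c : Literature.AlgebraicGeometry.HodgeTheory.complexBetti X (2 * p)), Literature.AlgebraicGeometry.HodgeTheory.IsRationalClass c → A.pullback (2 * p) c ∈ A.hodgePQ (2 * p) p p → ∃ (m : ℕ) (b : Literature.AlgebraicGeometry.HodgeTheory.complexBetti X (2 * p)) (S : Set A.carrier), 0 < m ∧ b ∈ Literature.AlgebraicGeometry.HodgeTheory.algebraicClasses X p ∧ (Literature.Geometry.Kaehler.IsAnalyticSet 𝓘(ℂ, A.model) S ∧ ∀ x ∈ Literature.Geometry.Kaehler.regularLocus 𝓘(ℂ, A.model) S, ∀ q : ℕ, Literature.Geometry.Kaehler.IsRegularPointOfCodim 𝓘(ℂ, A.model) S q x → p ≤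 q) ∧ Literature.AlgebraicTopology.SingularHomology.singularCohomology.map ℂ ℂ (⟨Subtype.val, continuous_subtype_val⟩ : C({x : A.carrier // x ∉ S}, A.carrier)) (2 * p) (A.pullback (2 * p) ((m : ℂ) • c + b)) = 0

-- earlier RateGap (stmt-HodgeConjecture-2736, replaced 2026-08-15T16:23:23Z -> stmt-HodgeConjecture-10762): retired by None — ∀ (n p : ℕ) (X : Literature.AlgebraicGeometry.Motives.SchemeOver ℂ), Literature.AlgebraicGeometry.Motives.IsSmoothProjective n X → p ≤ n → ∀ (A : Literature.AlgebraicGeometry.HodgeTheory.HodgeModel n X) (c : Literature.AlgebraicGeometry.HodgeTheory.complexBetti X (2 * p)), Li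
/-- item stmt-HodgeConjecture-10762 · aside · rank 2 · open · by planner
why it might fail: Only t = 0 (HC itself, via an irreducible representative of m*c + a*h^p) is known to beat k^{-p}: AH carriers give defect ~k^{-1/2} on zero loci [Donaldson1996] (~1/k at best), and a curvature gap (sup|F^{0,2}| ~ k^{1-p} for every rank-p carrier of a Weil-type class) leaves R1 exactly as hard as HC.
sources: Donaldson1996, Auroux1997, MunozPresasSols2002, Ramadas2008Spin7, VoisinHodgeI2002
[crux] R1 of the card ('Hodge ⟹ rate > p'): for X smooth projective of dimension n, p ≤ n, every
Hodge model A and every rational class c of type (p,p) there are a smooth Riemannian metric g on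
X^an, m ≥ 1, a rational algebraic class hp ∈ N^p H^{2p} (intended h^p), C, integers a_k ≤ C·k^p, δ >
0 and C' such that for infinitely many k the ray class m·c + a_k·hp is SUPPORTED on S (its pull-back
to the Hodge model dies on X^an ∖ S, the support formulation of lefschetzOneOne_rational_of) for
some S carrying a NEARLY HOLOMORPHIC CYCLE SUPPORT of defect ≤ C'·k^{-(p+δ)}: a closed S ⊇ Sg
(closed) with S∖Sg a CONNECTED C¹ real submanifold of codimension 2p (local C¹ submersion charts f :
X^an → ℝ^{2p}) all of whose tangent planes V satisfy ∀ v ∈ V ∃ w ∈ V, g(Jv−w, Jv−w) ≤ t²·g(v,v) (J =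
tangentJ, g the metric), S analytic near Sg, and Sg inside a closed analytic set whose regular
points have codimension ≥ p+1 (irreducible holomorphic chains: t = 0, Sg = Sing; Donaldson–Auroux
zero loci: Sg = ∅). Intended mechanism: carriers E_k (rank p, c_p = m·c, lower c_i = 0) whose
(0,2)-curvature decays, sup|F^{0,2}_{E_k}| = o(k^{1−p}) on the zero locus, fed into Donaldson–Auroux
globalisation (Universa -/
@[route_item "route-HodgeConjecture-HolomorphicityRate"]
def RateGap : Prop :=
  ∀ (n p : ℕ) (X : Literature.AlgebraicGeometry.Motives.SchemeOver ℂ), Literature.AlgebraicGeometry.Motives.IsSmoothProjective n X → p ≤ n → ∀ (A : Literature.AlgebraicGeometry.HodgeTheory.HodgeModel n X) (c : Literature.AlgebraicGeometry.HodgeTheory.complexBetti X (2 * p)), Literature.AlgebraicGeometry.HodgeTheory.IsRationalClass c → A.pullback (2 * p) c ∈ A.hodgePQ (2 * p) p p → ∃ (g : Bundle.ContMDiffRiemannianMetric 𝓘(ℝ, A.model) ((⊤ : ℕ∞) : WithTop ℕ∞) A.model (fun x : A.carrier => TangentSpace 𝓘(ℝ, A.model) x)) (m : ℕ) (hp : Literature.AlgebraicGeometry.HodgeTheory.complexBetti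 X (2 * p)) (C : ℝ) (a : ℕ → ℕ) (δ C' : ℝ), 0 < m ∧ Literature.AlgebraicGeometry.HodgeTheory.IsRationalClass hp ∧ hp ∈ Literature.AlgebraicGeometry.HodgeTheory.algebraicClasses X p ∧ (∀ k, (a k : ℝ) ≤ C * (k : ℝ) ^ p) ∧ 0 < δ ∧ ∃ᶠ k : ℕ in Filter.atTop, ∃ S Sg : Set A.carrier, (IsClosed S ∧ IsClosed Sg ∧ Sg ⊆ S ∧ IsConnected (S \ Sg) ∧ (∀ x ∈ Sg, Literature.Geometry.Kaehler.IsAnalyticSetAt 𝓘(ℂ, A.model) S x) ∧ (∃ T : Set A.carrier, Sg ⊆ T ∧ (Literature.Geometry.Kaehler.IsAnalyticSet 𝓘(ℂ, A.model) T ∧ ∀ x ∈ Literature.Geometry.Kaehler.regularLocus 𝓘(ℂ, A.model) T, ∀ q : ℕ, Literature.Geometry.Kaehler.IsRegularPointOfCodim 𝓘(ℂ, A.model) T q x → p + 1 ≤ q)) ∧ (∀ x ∈ S \ Sg, ∃ U : Set A.carrier, IsOpen U ∧ x ∈ U ∧ ∃ f : A.carrier → (Fin (2 * p) → ℝ), ContMDiffOn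 𝓘(ℝ, A.model) 𝓘(ℝ, Fin (2 * p) → ℝ) 1 f U ∧ S ∩ U = U ∩ f ⁻¹' {0} ∧ Function.Surjective (mfderiv 𝓘(ℝ, A.model) 𝓘(ℝ, Fin (2 * p) → ℝ) f x) ∧ ∀ v : TangentSpace 𝓘(ℝ, A.model) x, mfderiv 𝓘(ℝ, A.model) 𝓘(ℝ, Fin (2 * p) → ℝ) f x v = 0 → ∃ w : TangentSpace 𝓘(ℝ, A.model) x, mfderiv 𝓘(ℝ, A.model) 𝓘(ℝ, Fin (2 * p) → ℝ) f x w = 0 ∧ g.inner x (Literature.Geometry.Kaehler.tangentJ A.model x v - w) (Literature.Geometry.Kaehler.tangentJ A.model x v - w) ≤ (C' * (k : ℝ) ^ (-((p : ℝ) + δ))) ^ 2 * g.inner x v v)) ∧ Literature.AlgebraicTopology.SingularHomology.singularCohomology.map ℂ ℂ (⟨Subtype.val, continuous_subtype_val⟩ : C({x : A.carrier // x ∉ S}, A.carrier)) (2 * p) (A.pullback (2 * p) (((m : ℂ) • c + ((a k : ℕ) : ℂ) • hp))) = 0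

/-- item stmt-HodgeConjecture-2737 · aside · rank 3 · open · by planner
why it might fail: Implied by HC (E2 + Thom iso: [S_k] is an integral (p,p) class), nothing HC-free known: small Kaehler angle forces holomorphy only with extra structure (KE, minimality [HanLi2005, ArezzoSun2015]); the normal dbar-cokernel keeps k-independent blocks (H^{0,2}(X), p=1); limits may be non-chains.
sources: HanLi2005, ArezzoSun2015, King1971, HarveyShiffman1974, Donaldson1996, Ramadas2008Spin7
[crux] R2 of the card (super-threshold rigidity), universally quantified: for X smooth projective of
dimension n, p ≤ n, a Hodge model A, a smooth metric g, ANY class c ∈ H^{2p}(X(ℂ);ℂ), hp rational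
algebraic, m ≥ 1, a_k ≤ C·k^p, δ > 0, C': if for infinitely many k the class m·c + a_k·hp is
SUPPORTED on S (its pull-back to the Hodge model dies on X^an ∖ S, the support formulation of
lefschetzOneOne_rational_of) for some S carrying a NEARLY HOLOMORPHIC CYCLE SUPPORT of defect ≤
C'·k^{-(p+δ)}: a closed S ⊇ Sg (closed) with S∖Sg a CONNECTED C¹ real submanifold of codimension 2p
(local C¹ submersion charts f : X^an → ℝ^{2p}) all of whose tangent planes V satisfy ∀ v ∈ V ∃ w ∈
V, g(Jv−w, Jv−w) ≤ t²·g(v,v) (J = tangentJ, g the metric), S analytic near Sg, and Sg inside a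
closed analytic set whose regular points have codimension ≥ p+1 (irreducible holomorphic chains: t =
0, Sg = Sing; Donaldson–Auroux zero loci: Sg = ∅), then for some k that class is supported on a
closed analytic subset all of whose regular points have codimension ≥ p. Intended proof:
Newton–Kuranishi correction of S_k in (X, kω) by normal graphs — linearisation = ∂̄ of the almost
holomorphic normal bundle, k-positive (H -/
@[route_item "route-HodgeConjecture-HolomorphicityRate", crux]
def SuperThresholdRigidity : Prop :=
  ∀ (n p : ℕ) (X : Literature.AlgebraicGeometry.Motives.SchemeOver ℂ), Literature.AlgebraicGeometry.Motives.IsSmoothProjective n X → p ≤ n → ∀ (A : Literature.AlgebraicGeometry.HodgeTheory.HodgeModel n X) (g : Bundle.ContMDiffRiemannianMetric 𝓘(ℝ, A.model) ((⊤ : ℕ∞) : WithTop ℕ∞) A.model (fun x : A.carrier => TangentSpace 𝓘(ℝ, A.model) x)) (c hp : Literature.AlgebraicGeometry.HodgeTheory.complexBetti X (2 * p)) (m : ℕ) (C : ℝ) (a : ℕ → ℕ) (δ C' : ℝ), Literature.AlgebraicGeometry.HodgeTheory.IsRationalClass hp → hp ∈ Literature.AlgebraicGeometry.HodgeTheory.algebraicClasses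 X p → 0 < m → (∀ k, (a k : ℝ) ≤ C * (k : ℝ) ^ p) → 0 < δ → (∃ᶠ k : ℕ in Filter.atTop, ∃ S Sg : Set A.carrier, (IsClosed S ∧ IsClosed Sg ∧ Sg ⊆ S ∧ IsConnected (S \ Sg) ∧ (∀ x ∈ Sg, Literature.Geometry.Kaehler.IsAnalyticSetAt 𝓘(ℂ, A.model) S x) ∧ (∃ T : Set A.carrier, Sg ⊆ T ∧ (Literature.Geometry.Kaehler.IsAnalyticSet 𝓘(ℂ, A.model) T ∧ ∀ x ∈ Literature.Geometry.Kaehler.regularLocus 𝓘(ℂ, A.model) T, ∀ q : ℕ, Literature.Geometry.Kaehler.IsRegularPointOfCodim 𝓘(ℂ, A.model) T q x → p + 1 ≤ q)) ∧ (∀ x ∈ S \ Sg, ∃ U : Set A.carrier, IsOpen U ∧ x ∈ U ∧ ∃ f : A.carrier → (Fin (2 * p) → ℝ), ContMDiffOn 𝓘(ℝ, A.model) 𝓘(ℝ, Fin (2 * p) → ℝ) 1 f U ∧ S ∩ U = U ∩ f ⁻¹' {0} ∧ Function.Surjective (mfderiv 𝓘(ℝ, A.model) 𝓘(ℝ, Fin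 (2 * p) → ℝ) f x) ∧ ∀ v : TangentSpace 𝓘(ℝ, A.model) x, mfderiv 𝓘(ℝ, A.model) 𝓘(ℝ, Fin (2 * p) → ℝ) f x v = 0 → ∃ w : TangentSpace 𝓘(ℝ, A.model) x, mfderiv 𝓘(ℝ, A.model) 𝓘(ℝ, Fin (2 * p) → ℝ) f x w = 0 ∧ g.inner x (Literature.Geometry.Kaehler.tangentJ A.model x v - w) (Literature.Geometry.Kaehler.tangentJ A.model x v - w) ≤ (C' * (k : ℝ) ^ (-((p : ℝ) + δ))) ^ 2 * g.inner x v v)) ∧ Literature.AlgebraicTopology.SingularHomology.singularCohomology.map ℂ ℂ (⟨Subtype.val, continuous_subtype_val⟩ : C({x : A.carrier // x ∉ S}, A.carrier)) (2 * p) (A.pullback (2 * p) (((m : ℂ) • c + ((a k : ℕ) : ℂ) • hp))) = 0) → ∃ (k : ℕ) (S : Set A.carrier), (Literature.Geometry.Kaehler.IsAnalyticSet 𝓘(ℂ, A.model) S ∧ ∀ x ∈ Literature.Geometry.Kaehler.regularLocus 𝓘(ℂ, A.model) S, ∀ q : ℕ, Literature.Geometry.Kaehler.IsRegularPointOfCodim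 𝓘(ℂ, A.model) S q x → p ≤ q) ∧ Literature.AlgebraicTopology.SingularHomology.singularCohomology.map ℂ ℂ (⟨Subtype.val, continuous_subtype_val⟩ : C({x : A.carrier // x ∉ S}, A.carrier)) (2 * p) (A.pullback (2 * p) (((m : ℂ) • c + ((a k : ℕ) : ℂ) • hp))) = 0

-- earlier ThresholdForcesHodgeType (stmt-HodgeConjecture-2739, replaced 2026-08-15T16:23:23Z -> stmt-HodgeConjecture-10764): retired by None — ∀ (n p : ℕ) (X : Literature.AlgebraicGeometry.Motives.SchemeOver ℂ), Literature.AlgebraicGeometry.Motives.IsSmoothProjective n X → p ≤ n → ∀ (A : Literature.AlgebraicGeometry.HodgeTheory.HodgeModel n X) (g : Bundle.ContMDiffRiemannianMetric 𝓘(ℝ, A.model) ((⊤ 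
/-- item stmt-HodgeConjecture-10764 · support · rank 9 · open · by planner
sources: VoisinHodgeI2002, King1971, HarveyLawson2009
[support] E2 of the card (threshold lemma): for any class c, hp rational algebraic, m ≥ 1, a_k ≤
C·k^p and defects t_k with t_k·k^p → 0, if for infinitely many k the class m·c + a_k·hp is supported
on a nearly holomorphic cycle support of defect ≤ t_k, then c is of type (p,p). Proof: S∖Sg
connected and nearly complex ⟹ H^{2p}_S(X^an) = ℂ·[S] (Thom isomorphism off an analytic set of codim
≥ p+1), so γ_k = λ[S]; for a closed (r,s)-form ψ with r+s = 2(n−p), r ≠ s: ⟨γ_k ∪ [ψ]⟩ = λ∫_S ψ, |ψ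
restricted to T S| ≤ C·t_k·|ψ| (off-type forms vanish on complex (n−p)-planes) and Mass(S) ≤ (1 + C
t_k²)·∫_S ω^{n−p}/(n−p)!, whence |m⟨c ∪ ψ⟩| = O(t_k k^p) → 0 (hp is (p,p)); Serre duality kills
every c^{p−j,p+j}. [difficulty: L] -/
@[route_item "route-HodgeConjecture-HolomorphicityRate", crux]
def ThresholdForcesHodgeType : Prop :=
  ∀ (n p : ℕ) (X : Literature.AlgebraicGeometry.Motives.SchemeOver ℂ), Literature.AlgebraicGeometry.Motives.IsSmoothProjective n X → p ≤ n → ∀ (A : Literature.AlgebraicGeometry.HodgeTheory.HodgeModel n X) (g : Bundle.ContMDiffRiemannianMetric 𝓘(ℝ, A.model) ((⊤ : ℕ∞) : WithTop ℕ∞) A.model (fun x : A.carrier => TangentSpace 𝓘(ℝ, A.model) x)) (c hp : Literature.AlgebraicGeometry.HodgeTheory.complexBetti X (2 * p)) (m : ℕ) (C : ℝ) (a : ℕ → ℕ) (t : ℕ → ℝ), Literature.AlgebraicGeometry.HodgeTheory.IsRationalClass hp → hp ∈ Literature.AlgebraicGeometry.HodgeTheory.algebraicClasses X p → 0 < m →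 (∀ k, (a k : ℝ) ≤ C * (k : ℝ) ^ p) → Filter.Tendsto (fun k : ℕ => t k * (k : ℝ) ^ p) Filter.atTop (nhds 0) → (∃ᶠ k : ℕ in Filter.atTop, ∃ S Sg : Set A.carrier, (IsClosed S ∧ IsClosed Sg ∧ Sg ⊆ S ∧ IsConnected (S \ Sg) ∧ (∀ x ∈ Sg, Literature.Geometry.Kaehler.IsAnalyticSetAt 𝓘(ℂ, A.model) S x) ∧ (∃ T : Set A.carrier, Sg ⊆ T ∧ (Literature.Geometry.Kaehler.IsAnalyticSet 𝓘(ℂ, A.model) T ∧ ∀ x ∈ Literature.Geometry.Kaehler.regularLocus 𝓘(ℂ, A.model) T, ∀ q : ℕ, Literature.Geometry.Kaehler.IsRegularPointOfCodim 𝓘(ℂ, A.model) T q x → p + 1 ≤ q)) ∧ (∀ x ∈ S \ Sg, ∃ U : Set A.carrier, IsOpen U ∧ x ∈ U ∧ ∃ f : A.carrier → (Fin (2 * p) → ℝ), ContMDiffOn 𝓘(ℝ, A.model) 𝓘(ℝ, Fin (2 * p) → ℝ) 1 f U ∧ S ∩ U = U ∩ f ⁻¹' {0} ∧ Function.Surjective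 (mfderiv 𝓘(ℝ, A.model) 𝓘(ℝ, Fin (2 * p) → ℝ) f x) ∧ ∀ v : TangentSpace 𝓘(ℝ, A.model) x, mfderiv 𝓘(ℝ, A.model) 𝓘(ℝ, Fin (2 * p) → ℝ) f x v = 0 → ∃ w : TangentSpace 𝓘(ℝ, A.model) x, mfderiv 𝓘(ℝ, A.model) 𝓘(ℝ, Fin (2 * p) → ℝ) f x w = 0 ∧ g.inner x (Literature.Geometry.Kaehler.tangentJ A.model x v - w) (Literature.Geometry.Kaehler.tangentJ A.model x v - w) ≤ (t k) ^ 2 * g.inner x v v)) ∧ Literature.AlgebraicTopology.SingularHomology.singularCohomology.map ℂ ℂ (⟨Subtype.val, continuous_subtype_val⟩ : C({x : A.carrier // x ∉ S}, A.carrier)) (2 * p) (A.pullback (2 * p) (((m : ℂ) • c + ((a k : ℕ) : ℂ) • hp))) = 0) → A.pullback (2 * p) c ∈ A.hodgePQ (2 * p) p p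

/-- item stmt-HodgeConjecture-14253 · support · rank 9 · closed · proved by Summit.HodgeConjecture.HodgeConjecture.Theorems.holomorphicityRate_targetOfCruxes_proof (prover) · by planner
[support] Glue Crux… → Target (route-choice (a), clears route.target-unreachable): the two ranked
cruxes RateGap (R1) and SuperThresholdRigidity (R2) deliver the target X₀. For X smooth projective
of dimension n, p ≤ n, a Hodge model A and a rational class c with A.pullback c of type (p,p), R1
supplies the ray data (g, m ≥ 1, hp rational algebraic, C, a_k ≤ C·k^p, δ > 0, C′) with
super-threshold nearly-holomorphic supports of m·c + a_k·hp for infinitely many k — syntactically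
the hypotheses of R2 — and R2 returns one k and a closed analytic S ⊆ X^an with regular points of
codimension ≥ p off which m·c + a_k·hp dies; take b := a_k·hp, algebraic because hp ∈ Nᵖ H²ᵖ is a
ℂ-submodule (Submodule.smul_mem). Pure logic, sorry-free in the planner Sketch.lean (theorem
target_of_cruxes, lean check rc 0), attached as evidence; with TargetSuffices (Target →
AnalyticSupportAlgebraic → HodgeModelsExist → Statement) the target now sits on the path cruxes →
Target → Statement, parallel to the certified deciding theorem closes. [difficulty: provable-now]
[Deligne2000] -/
@[route_item "route-HodgeConjecture-HolomorphicityRate"]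
def TargetOfCruxes : Prop :=
  RateGap → SuperThresholdRigidity → Target

/-- item stmt-HodgeConjecture-18026 · support · rank 9 · closed · proved by Summit.HodgeConjecture.HodgeConjecture.Theorems.polarisedLefschetzData_proof @ 934a421cd36a (prover) · by planner
sources: VoisinHodgeI2002, VoisinHodgeII2003
[support] anti-vacuity of the pin, consumed by `closes`: every smooth projective n-fold carries a
hard-Lefschetz datum Lambda whose class h = Lambda.hyperplaneClass is KAEHLER (IsKaehlerClass n X h)
and all of whose cup powers h^p = cupPowTwo h p are algebraic. Provable now from the tree: h := r
[theta_iota] for the restricted Fubini-Study form of a projective embedding and the r > 0 of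
exists_pos_smul_isRationalClass_of_pullback_eq_fubiniStudy (HardLefschetzNFoldHolds); Lambda from
HodgeModel.exists_hardLefschetzNFold_of_pullback_eq_fubiniStudy_smul (w := r); Kaehler by
HodgeModel.isKaehlerClassVia_of_pullback_eq_fubiniStudyPullbackForm + IsKaehlerClassVia.smul_of_pos
+ IsKaehlerClassVia.isKaehlerClass (KaehlerClass); powers algebraic by induction from
algebraicClasses_zero (h^0 = 1), cupPowTwo_succ, the field
Lambda.lefschetzOperator_mem_algebraicClasses and even-degree commutativity
cupPowTwo_cupProduct_comm / lefschetzPow_eq_cupPowTwo_cupProduct (HodgeRiemannDegreeOneProofs).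
[difficulty: M] -/
@[route_item "route-HodgeConjecture-HolomorphicityRate", crux]
def PolarisedLefschetzData : Prop :=
  ∀ (n : ℕ) (X : Literature.AlgebraicGeometry.Motives.SchemeOver ℂ), Literature.AlgebraicGeometry.Motives.IsSmoothProjective n X → ∃ Λ : Literature.AlgebraicGeometry.HodgeTheory.HardLefschetzNFold n X, Literature.AlgebraicGeometry.HodgeTheory.IsKaehlerClass n X Λ.hyperplaneClass ∧ ∀ p : ℕ, Literature.AlgebraicGeometry.HodgeTheory.cupPowTwo Λ.hyperplaneClass p ∈ Literature.AlgebraicGeometry.HodgeTheory.algebraicClasses X p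

-- earlier RateGapPinned (stmt-HodgeConjecture-18024, replaced 2026-08-17T11:20:04Z -> stmt-HodgeConjecture-18079): retired by None — ∀ (n p : ℕ) (X : Literature.AlgebraicGeometry.Motives.SchemeOver ℂ), Literature.AlgebraicGeometry.Motives.IsSmoothProjective n X → 1 ≤ p → p < n → ∀ (A : Literature.AlgebraicGeometry.HodgeTheory.HodgeModel n X), A.IsChernNormalised → ∀ (Λ : Literature.AlgebraicGeometry
/-- item stmt-HodgeConjecture-18079 · support · rank 9 · open · by planner
sources: Donaldson1996, Auroux1997, VoisinHodgeI2002
[support] R1′, the rate-gap WAYPOINT on the pinned ray — RESTATED (rbadge g4): the Hodge-type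
hypothesis is the summit's ∃-form `IsOfHodgeType n X (2*p) p p c` instead of the model-internal
`A.pullback (2*p) c ∈ A.hodgePQ (2*p) p p` (equivalent by the PROVED Literature fact
hodgePQ_independent_of_hodgeModel_holds, whose Morse-theoretic proof module thereby leaves the route
file's imports for the Theorems proof of RateGapPinnedOfCarriers). Otherwise verbatim: for X smooth
projective of dimension n, 1 ≤ p < n, A a CHERN-NORMALISED Hodge model, Λ a hard-Lefschetz datum
whose class h is KÄHLER, and every rational class c of type (p,p): there are a smooth metric g, m ≥
1, d ≥ 1, C, integers a_k ≤ C·k^p, δ > 0, C′ such that for infinitely many k a nearly holomorphic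
cycle support of defect ≤ C′·k^{-(p+δ)}
(Literature.Geometry.Kaehler.IsNearlyHolomorphicCycleSupport) carries m·c + (a_k·d)·h^p (its
pull-back to X^an dies off the support). Delivered by the glue RateGapPinnedOfCarriers from the
cruxes CarrierCurvatureDecay + AHGlobalisationWithRate (provable now: logic, linearity of
A.pullback, one transport — planner ProofSketch.lean rc 0); consumed by `closes` as the input of
SuperThreshol -/
@[route_item "route-HodgeConjecture-HolomorphicityRate"]
def RateGapPinned : Prop :=
  ∀ (n p : ℕ) (X : Literature.AlgebraicGeometry.Motives.SchemeOver ℂ), Literature.AlgebraicGeometry.Motives.IsSmoothProjective n X → 1 ≤ p → p < n → ∀ (A : Literature.AlgebraicGeometry.HodgeTheory.HodgeModel n X), A.IsChernNormalised → ∀ (Λ : Literature.AlgebraicGeometry.HodgeTheory.HardLefschetzNFold n X), Literature.AlgebraicGeometry.HodgeTheory.IsKaehlerClass n X Λ.hyperplaneClass → ∀ (c : Literature.AlgebraicGeometry.HodgeTheory.complexBetti X (2 * p)), Literature.AlgebraicGeometry.HodgeTheory.IsRationalClass c → Literature.AlgebraicGeometry.HodgeTheory.IsOfHodgeType n X (2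 * p) p p c → ∃ (g : Bundle.ContMDiffRiemannianMetric 𝓘(ℝ, A.model) ((⊤ : ℕ∞) : WithTop ℕ∞) A.model (fun x : A.carrier => TangentSpace 𝓘(ℝ, A.model) x)) (m d : ℕ) (C : ℝ) (a : ℕ → ℕ) (δ C' : ℝ), 0 < m ∧ 0 < d ∧ (∀ k, (a k : ℝ) ≤ C * (k : ℝ) ^ p) ∧ 0 < δ ∧ ∃ᶠ k : ℕ in Filter.atTop, ∃ S Sg : Set A.carrier, Literature.Geometry.Kaehler.IsNearlyHolomorphicCycleSupport g.toRiemannianMetric p (C' * (k : ℝ) ^ (-((p : ℝ) + δ))) S Sg ∧ Literature.AlgebraicTopology.SingularHomology.singularCohomology.map ℂ ℂ (⟨Subtype.val, continuous_subtype_val⟩ : C({x : A.carrier // x ∉ S}, A.carrier)) (2 * p) (A.pullback (2 * p) ((m : ℂ) • c + ((a k * d : ℕ) : ℂ) • Literature.AlgebraicGeometry.HodgeTheory.cupPowTwo Λ.hyperplaneClass p)) = 0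

-- earlier RateGapPinnedOfCarriers (stmt-HodgeConjecture-18025, replaced 2026-08-17T13:45:21Z -> stmt-HodgeConjecture-18208): retired by None — CarrierCurvatureDecay → AHGlobalisationWithRate → RateGapPinned
/-- item stmt-HodgeConjecture-18208 · support · rank 9 · closed · proved by Summit.HodgeConjecture.HodgeConjecture.Theorems.rateGapPinnedOfCarriers_proof @ ca2e9093fd0e (prover) · by planner
sources: VoisinHodgeI2002
[support] GLUE of the carrier split: CarrierCurvatureDecay -> AHGlobalisationWithRate ->
RateGapPinned. Pure logic: take the carrier (g, F, m, C, delta, D_k) of R1a for (A, c), feed it to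
R1b with the given (Lambda, h) to get d, C' and eventually-in-k zero loci S_k (Sg = emptyset)
carrying (-1)^{p-1}(p-1)! ch_p(F) + (k^p d) A^*h^p = A^*(m c + (k^p d) h^p) by linearity of A^* and
the Chern identity of R1a; a_k := k^p, C := 1; eventually => frequently. SORRY-FREE in the planner's
Sketch.lean (theorem rateGapPinnedOfCarriers_holds, lean check rc 0, attached as evidence): provable
now, verbatim. [difficulty: provable-now] -/
@[route_item "route-HodgeConjecture-HolomorphicityRate", crux]
def RateGapPinnedOfCarriers : Prop :=
  CarrierCurvatureDecay → AHGlobalisationWithRate → ∀ (n p : ℕ) (X : Literature.AlgebraicGeometry.Motives.SchemeOver ℂ), Literature.AlgebraicGeometry.Motives.IsSmoothProjective n X → 1 ≤ p → p < n → ∀ (A : Literature.AlgebraicGeometry.HodgeTheory.HodgeModel n X), A.IsChernNormalised → ∀ (Λ : Literature.AlgebraicGeometry.HodgeTheory.HardLefschetzNFold n X), Literature.AlgebraicGeometry.HodgeTheory.IsKaehlerClass n X Λ.hyperplaneClass → ∀ (c : Literature.AlgebraicGeometry.HodgeTheory.complexBetti X (2 * p)), Literature.AlgebraicGeometry.HodgeTheory.IsRationalClass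 c → Literature.AlgebraicGeometry.HodgeTheory.IsOfHodgeType n X (2 * p) p p c → ∃ (g : Bundle.ContMDiffRiemannianMetric 𝓘(ℝ, A.model) ((⊤ : ℕ∞) : WithTop ℕ∞) A.model (fun x : A.carrier => TangentSpace 𝓘(ℝ, A.model) x)) (m d : ℕ) (C : ℝ) (a : ℕ → ℕ) (δ C' : ℝ), 0 < m ∧ 0 < d ∧ (∀ k, (a k : ℝ) ≤ C * (k : ℝ) ^ p) ∧ 0 < δ ∧ ∃ᶠ k : ℕ in Filter.atTop, ∃ S Sg : Set A.carrier, Literature.Geometry.Kaehler.IsNearlyHolomorphicCycleSupport g.toRiemannianMetric p (C' * (k : ℝ) ^ (-((p : ℝ) + δ))) S Sg ∧ Literature.AlgebraicTopology.SingularHomology.singularCohomology.map ℂ ℂ (⟨Subtype.val, continuous_subtype_val⟩ : C({x : A.carrier // x ∉ S}, A.carrier)) (2 * p) (A.pullback (2 * p) ((m : ℂ) • c + ((a k * d : ℕ) : ℂ) • Literature.AlgebraicGeometry.HodgeTheory.cupPowTwo Λ.hyperplaneClass p)) = 0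

/-- item stmt-HodgeConjecture-2741 · support · rank 9 · closed · proved by Summit.HodgeConjecture.HodgeConjecture.Theorems.analyticSupportAlgebraic_proof @ 3dc2fc9a8b94 (prover) · by planner
sources: SerreGAGA1956, Chow1949, VoisinHodgeI2002
[support] Chow/GAGA glue: a class c ∈ H^{2p}(X(ℂ);ℂ) whose pull-back to a Hodge model dies off a
closed analytic subset S all of whose regular points have codimension ≥ p lies in algebraicClasses X
p = N^p H^{2p}. Proof: chow_analyticSet_analytification (tree; rests on hodge.S17 = Chow in ℙᴺ)
gives S = φ⁻¹(Z(ℂ)) with Z Zariski-closed, GAGA dimension comparison gives coheight ≥ p on Z,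
restrictCompl_eq_zero_of_pullback transports the vanishing; the p = 1 instance is literally the
tree's lefschetzOneOne_rational_of. [difficulty: M] -/
@[route_item "route-HodgeConjecture-HolomorphicityRate", crux]
def AnalyticSupportAlgebraic : Prop :=
  ∀ (n p : ℕ) (X : Literature.AlgebraicGeometry.Motives.SchemeOver ℂ), Literature.AlgebraicGeometry.Motives.IsSmoothProjective n X → ∀ (A : Literature.AlgebraicGeometry.HodgeTheory.HodgeModel n X) (c : Literature.AlgebraicGeometry.HodgeTheory.complexBetti X (2 * p)) (S : Set A.carrier), (Literature.Geometry.Kaehler.IsAnalyticSet 𝓘(ℂ, A.model) S ∧ ∀ x ∈ Literature.Geometry.Kaehler.regularLocus 𝓘(ℂ, A.model) S, ∀ q : ℕ, Literature.Geometry.Kaehler.IsRegularPointOfCodim 𝓘(ℂ, A.model) S q x → p ≤ q) → Literature.AlgebraicTopology.SingularHomology.singularCohomology.map ℂ ℂ (⟨Subtype.val, continuous_subtype_val⟩ : C({x : A.carrier // x ∉ S}, A.carrier)) (2 * p) (A.pullback (2 * p) (c)) = 0 → c ∈ Literature.AlgebraicGeometry.HodgeTheory.algebraicClasses X p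

/-- item stmt-HodgeConjecture-2742 · support · rank 9 · closed · proved by Summit.HodgeConjecture.HodgeConjecture.Theorems.holomorphicDefect_hodgeModelsExist_proof @ 852a466105f7 (prover) · by planner
sources: SerreGAGA1956, VoisinHodgeI2002
[support] = ∀ n X, Literature.AlgebraicGeometry.HodgeTheory.nonempty_hodgeModel n X (Serre GAGA §2 +
de Rham + the Hodge decomposition of the compact Kähler X^an); tree named fact, discharge in
progress (HodgeModelExistenceDischarge). [difficulty: L] -/
@[route_item "route-HodgeConjecture-HolomorphicityRate", crux]
def HodgeModelsExist : Prop :=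
  ∀ (n : ℕ) (X : Literature.AlgebraicGeometry.Motives.SchemeOver ℂ), Literature.AlgebraicGeometry.Motives.IsSmoothProjective n X → Nonempty (Literature.AlgebraicGeometry.HodgeTheory.HodgeModel n X)

/-- `HodgeModelsExist` holds: proved by `Summit.HodgeConjecture.HodgeConjecture.Theorems.holomorphicDefect_hodgeModelsExist_proof` @ 852a466105f7. -/
theorem HodgeModelsExist_holds : HodgeModelsExist := _root_.Summit.HodgeConjecture.HodgeConjecture.Theorems.holomorphicDefect_hodgeModelsExist_proof

/-- item stmt-HodgeConjecture-2743 · support · rank 9 · closed · proved by Summit.HodgeConjecture.HodgeConjecture.Theorems.TargetSuffices_proof @ 01abd5044f03 (prover) · by planner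
sources: Deligne2000
[support] Target → AnalyticSupportAlgebraic → HodgeModelsExist → HodgeConjecture (pure logic +
IsOfHodgeType.eq_zero_pp_of_lt for p > n; sorry-free in the planner's Sketch.lean, attached as
evidence). [difficulty: provable-now] -/
@[route_item "route-HodgeConjecture-HolomorphicityRate"]
def TargetSuffices : Prop :=
  Target → AnalyticSupportAlgebraic → HodgeModelsExist → HodgeConjecture

/-- item stmt-HodgeConjecture-2744 · assembly · rank 1 · closed · proved by Summit.HodgeConjecture.HodgeConjecture.Theorems.holomorphicityRate_assembly_proof (prover) · by planner
sources: Deligne2000, SerreGAGA1956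
[assembly] RateGap → SuperThresholdRigidity → AnalyticSupportAlgebraic → HodgeModelsExist →
HodgeConjecture. -/
@[route_item "route-HodgeConjecture-HolomorphicityRate"]
def Assembly : Prop :=
  RateGap → SuperThresholdRigidity → AnalyticSupportAlgebraic → HodgeModelsExist → HodgeConjecture

-- records of items no longer active in this route (dropped / restated):
-- earlier SuperThresholdRigidityPinned (stmt-HodgeConjecture-18022, replaced 2026-08-17T11:20:04Z -> stmt-HodgeConjecture-18080): retired by None — ∀ (n p : ℕ) (X : Literature.AlgebraicGeometry.Motives.SchemeOver ℂ), Literature.AlgebraicGeometry.Motives.IsSmoothProjective n X → 1 ≤ p → p < n → ∀ (A : Literature.AlgebraicGeometry.HodgeTheory.HodgeModel n X) (Λ : Literature.AlgebraicGeometry.HodgeTheo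

/-! D-0027 §2.1 — DECIDING THEOREM (planner-authored via `route open/edit --closes-file`; by planner-rbadge-HodgeConjecture-HolomorphicityR-70b5ba77-g8-0 2026-08-17T14:49:38Z):
its hypotheses are this route's items and its conclusion the sub-problem Statement (glue_lint), and it elaborates with this file. -/

-- D-0027 §2.1 deciding theorem of route HolomorphicityRate over the LOCALISED rigidity crux R2″ (planner rbadge g7, re-certified
-- and landed by rbadge g8, 2026-08-17): binders = CarrierCurvatureDecay (R1a, stmt-18021), AHGlobalisationWithRate (R1b, stmt-18023),
-- the glue item RateGapPinnedOfCarriers (R1a → R1b → RateGapPinned, stmt-18208), SuperThresholdRigidityLocal (R2″, stmt-18204: fixed-k,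
-- LOCALISED rigidity — the load-bearing rigidity binder; R2 / R2′ fold onto HC≤middle and are aside / retired), PolarisedLefschetzData
-- (stmt-18026), AnalyticSupportAlgebraic (proved), HodgeModelsExist (proved); conclusion `_root_.HodgeConjecture` by name.
-- Logic + ℂ-submodule arithmetic only: lower half 2p ≤ n — p = 0 by algebraicClasses_zero; 1 ≤ p < n: Chern-normalise the ∃-model of
-- the Hodge-type hypothesis, take Λ from PolarisedLefschetzData, get the waypoint RateGapPinned from the glue, combine its
-- frequently-in-k supports with the eventually-in-k radius clause of R2″ (`Filter.Frequently.and_eventually`, `.exists`), discard the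
-- tube clause, apply Chow/GAGA to the analytic T, subtract (a_k d)•h^p ∈ Nᵖ, divide by m ≠ 0; upper half n < 2p by
-- HardLefschetzNFold.mem_algebraicClasses_of_lt.
@[closes "route-HodgeConjecture-HolomorphicityRate"] theorem closes (h₁ : CarrierCurvatureDecay) (h₂ : AHGlobalisationWithRate) (h₃ : RateGapPinnedOfCarriers)
    (h₄ : SuperThresholdRigidityLocal) (h₅ : PolarisedLefschetzData) (h₆ : AnalyticSupportAlgebraic)
    (h₇ : HodgeModelsExist) : _root_.HodgeConjecture := by
  intro n X hX
  refine ⟨h₇ n X hX, ?_⟩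
  obtain ⟨Λ, hΛK, hΛalg⟩ := h₅ n X hX
  have hR : RateGapPinned := h₃ h₁ h₂
  -- the lower half of the Hodge diamond: `2p ≤ n`
  have lower : ∀ p : ℕ, 2 * p ≤ n →
      ∀ c : Literature.AlgebraicGeometry.HodgeTheory.complexBetti X (2 * p),
        Literature.AlgebraicGeometry.HodgeTheory.IsRationalClass c →
        Literature.AlgebraicGeometry.HodgeTheory.IsOfHodgeType n X (2 * p) p p c →
        c ∈ Literature.AlgebraicGeometry.HodgeTheory.algebraicClasses X p := by
    intro p h2p c hc hH
    rcases Nat.eq_zero_or_pos p with rfl | hp1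
    · rw [Literature.AlgebraicGeometry.HodgeTheory.algebraicClasses_zero]
      exact Submodule.mem_top
    · have hpn : p < n := by omega
      obtain ⟨A₀, -⟩ := id hH
      have hA : A₀.chernNormalise.IsChernNormalised := A₀.isChernNormalised_chernNormalise
      obtain ⟨g, m, d, C, a, δ, C', hm, hd, hbud, hδ, hfreq⟩ :=
        hR n p X hX hp1 hpn A₀.chernNormalise hA Λ hΛK c hc hH
      obtain ⟨ρ, -, hev⟩ :=
        h₄ n p X hX hp1 hpn A₀.chernNormalise Λ hΛK g c m d C a δ C' hc hH hm hd hbud hδ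
      obtain ⟨k, ⟨S, Sg, hS, hcar⟩, hk⟩ := (hfreq.and_eventually hev).exists
      obtain ⟨T, hT, hsupp, -⟩ := hk S Sg hS hcar
      have hmem : ((m : ℂ) • c + ((a k * d : ℕ) : ℂ) •
          Literature.AlgebraicGeometry.HodgeTheory.cupPowTwo Λ.hyperplaneClass p) ∈
            Literature.AlgebraicGeometry.HodgeTheory.algebraicClasses X p :=
        h₆ n p X hX A₀.chernNormalise _ T hT hsupp
      have hb : (((a k * d : ℕ) : ℂ) • Literature.AlgebraicGeometry.HodgeTheory.cupPowTwo Λ.hyperplaneClass p) ∈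
          Literature.AlgebraicGeometry.HodgeTheory.algebraicClasses X p :=
        Submodule.smul_mem _ _ (hΛalg p)
      have hmc : ((m : ℂ) • c) ∈ Literature.AlgebraicGeometry.HodgeTheory.algebraicClasses X p := by
        have h := Submodule.sub_mem _ hmem hb
        rwa [add_sub_cancel_right] at h
      have hm0 : (m : ℂ) ≠ 0 := Nat.cast_ne_zero.2 hm.ne'
      have h := Submodule.smul_mem _ ((m : ℂ)⁻¹) hmc
      rwa [smul_smul, inv_mul_cancel₀ hm0, one_smul] at h
  intro p c hc hH
  by_cases h2p : 2 * p ≤ n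
  · exact lower p h2p c hc hH
  · exact Λ.mem_algebraicClasses_of_lt (by omega) (fun c' hc' hH' ↦ lower (n - p) (by omega) c' hc' hH') c hc hH

end Summit.HodgeConjecture.HodgeConjecture.Theses.HolomorphicityRate
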